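import Mathlib
import HarnessLib.Audit
import Summits.PneNP.PneNP.Theorems.PstarChordReadTwoGates

/-!
# The flip calculus of a terminal core: moves, commuting flips, rank one for arbitrary flips (ROUND-24, O1 at exact tightness; memo g21 §15)

FRONTIER range-avoidance ladder, rung F-N3, ROUND 24 (cell `pnp-ideate`, prover-2 memos `g19/O1-CHORD-READ.md` §6.5 (rank-one principle),
`g20/O1-CHORD-READ-g20.md` §13–§14 (residual: shared switch partners), `g21` §15 (the affine two-chord theorem); typed target
`PstarCoreBoundTargets.TerminalPeelable` (p646951); restricted-model proof complexity — nothing here bears on `P` versus `NP`).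

The g20 capstones (`false_of_two_simpleGates`, `false_of_two_switchGated`, `false_of_two_sharedGates`) compute the move of a reader under a
switch flip SYNTACTICALLY, one attachment pattern at a time (`coef_switch`, `coef_switch₂`).  The affine two-chord theorem of g21 treats ARBITRARY
attachment patterns, so it needs the move calculus for an arbitrary variable:

* `mv I C G v x` — the MOVE of the G-constraint `(C, G)` under flipping `x_v`: the read coefficient `coef v` at `x`, as a bit;
  `gval_flip`: `Γ(x ⊕ e_v) = Γ(x) ⊕ mv v x`;
* `mv_update_of_ne` — `mv v` is unchanged by flipping a variable `u` that shares no monomial of `G` with `v` (in particular by flipping `v` itself,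
  `mv_update_self`); `mv_update_of_gate` — it FLIPS when `u` shares a monomial `g ∈ G` with `v` (the monomial is unique by `SimpleOverlap`);
* `gval_flip₂` — two variables sharing no monomial act ADDITIVELY: `Γ(x ⊕ e_u ⊕ e_v) = Γ(x) ⊕ mv u x ⊕ mv v x`;
* `false_of_independent_flips` / `rank_one` — RANK ONE for two arbitrary commuting flips each keeping the core solved (outside variables, or a chord
  private while the other private is `0`): their move vectors `(mv₁ u, mv₂ u)`, `(mv₁ v, mv₂ v)` are linearly dependent at every such solution
  (generalises `PstarChordReadSwitch.false_of_independent_switches`, which requires both variables outside the core);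
* `solves_update_priv` — flipping a private of a chord while the other private is `0` keeps the core solved (both slots at once);
* the finite lemmas `parallel_of_two_point` / `types_of_four_point` — the determinant conditions at the two / four flips of one / two gated privates
  force a move vector onto the line of the gate type / force equal gate types (memo g20 §13.8 "uniform type", now pointwise and attachment-free).

No genericity, no Assumption A.
-/

set_option linter.dupNamespace false -- `Summit.PneNP.PneNP.…`: summit = sub-problem name (D-0017 single-conjunct layout)

open Finset Literature.Computability.Complexity
open Summit.PneNP.PneNP.Theorems.PstarFibrePolys (bit bit_injective)
open Summit.PneNP.PneNP.Theorems.PstarTyped (Typed)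
open Summit.PneNP.PneNP.Theorems.PstarSALevel (varSet bdry BoundaryExpanding SimpleOverlap)
open Summit.PneNP.PneNP.Theorems.PstarCentreFree (vars_mem_varSet)
open Summit.PneNP.PneNP.Theorems.PstarGapOneAll (gval)
open Summit.PneNP.PneNP.Theorems.PstarChordRepair (IsChord)
open Summit.PneNP.PneNP.Theorems.PstarCoreBoundTargets (Terminal)
open Summit.PneNP.PneNP.Theorems.PstarChordBridgeTools (coef)
open Summit.PneNP.PneNP.Theorems.PstarChordReadsGates (gval_update_not_coef)
open Summit.PneNP.PneNP.Theorems.PstarChordReads (solves_update_of_chord)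
open Summit.PneNP.PneNP.Theorems.PstarChordReadsMirror (solves_update_of_chord₃)

namespace Summit.PneNP.PneNP.Theorems.PstarChordReadFlip

variable {n m : ℕ}

/-! ## Moves -/
section Move

variable (I : LocalMap 4 n m) (C : Finset (Fin n)) (G : Finset (Fin m))

/-- The **MOVE** of the G-constraint `(C, G)` under flipping the variable `v` at the point `x`: its read coefficient
`[v ∈ C] + Σ_{g ∈ G, v ∈ g} x_{partner}` as a bit. -/
def mv (v : Fin n) (x : Fin n → Bool) : Bool :=
  decide (coef I C G v (fun w => bit (x w)) = 1)

/-- **Flipping `x_v` moves the reader by `mv v x`.** -/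
theorem gval_flip (hI : I.IsPure xorAndPred) (x : Fin n → Bool) (v : Fin n) :
    gval I C G (Function.update x v (!x v)) = xor (gval I C G x) (mv I C G v x) := by
  unfold mv
  rw [gval_update_not_coef I hI C G x v]
  by_cases h : coef I C G v (fun w => bit (x w)) = 1
  · rw [if_pos h, decide_eq_true h]; cases gval I C G x <;> rfl
  · rw [if_neg h, decide_eq_false h]; cases gval I C G x <;> rfl

/-- The read coefficient of `v` depends only on the values at the partners of `v` in the monomials of `G`. -/
theorem coef_congr (v : Fin n) {X X' : Fin n → ZMod 2}
    (h : ∀ g ∈ G, (I.vars g 2 = v → X (I.vars g 3) = X' (I.vars g 3)) ∧ (I.vars g 3 = v → X (I.vars g 2) = X' (I.vars g 2))) :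
    coef I C G v X = coef I C G v X' := by
  unfold coef
  congr 1
  refine sum_congr rfl fun g hg => ?_
  obtain ⟨h2, h3⟩ := h g hg
  congr 1
  · by_cases e : I.vars g 2 = v
    · rw [if_pos e, if_pos e, h2 e]
    · rw [if_neg e, if_neg e]
  · by_cases e : I.vars g 3 = v
    · rw [if_pos e, if_pos e, h3 e]
    · rw [if_neg e, if_neg e]

/-- **A flip that shares no monomial with `v` does not change `mv v`.** -/
theorem mv_update_of_ne {v u : Fin n} (hno : ∀ g ∈ G, ¬ ((I.vars g 2 = v ∧ I.vars g 3 = u) ∨ (I.vars g 2 = u ∧ I.vars g 3 = v)))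
    (x : Fin n → Bool) (b : Bool) : mv I C G v (Function.update x u b) = mv I C G v x := by
  unfold mv
  rw [coef_congr I C G v (X := fun w => bit (Function.update x u b w)) (X' := fun w => bit (x w))]
  intro g hg
  refine ⟨fun e => ?_, fun e => ?_⟩
  · have hne : I.vars g 3 ≠ u := fun e' => hno g hg (Or.inl ⟨e, e'⟩)
    simp only [Function.update_of_ne hne]
  · have hne : I.vars g 2 ≠ u := fun e' => hno g hg (Or.inr ⟨e', e⟩)
    simp only [Function.update_of_ne hne]

/-- In particular `mv v` does not see `x_v` (pure outputs have two distinct AND variables). -/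
theorem mv_update_self (hI : I.IsPure xorAndPred) (v : Fin n) (x : Fin n → Bool) (b : Bool) :
    mv I C G v (Function.update x v b) = mv I C G v x :=
  mv_update_of_ne I C G (fun g _ h => by
    rcases h with ⟨h2, h3⟩ | ⟨h2, h3⟩ <;> exact absurd (hI.2 g (h2.trans h3.symm)) (by decide)) x b

/-- Under simple overlaps, two distinct outputs never have the same AND pair. -/
theorem eq_of_pair (hS : SimpleOverlap I) {g g' : Fin m} {v u : Fin n} (hvu : v ≠ u)
    (hg : (I.vars g 2 = v ∧ I.vars g 3 = u) ∨ (I.vars g 2 = u ∧ I.vars g 3 = v))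
    (hg' : (I.vars g' 2 = v ∧ I.vars g' 3 = u) ∨ (I.vars g' 2 = u ∧ I.vars g' 3 = v)) : g = g' := by
  by_contra hne
  have hv : ∀ {h : Fin m}, ((I.vars h 2 = v ∧ I.vars h 3 = u) ∨ (I.vars h 2 = u ∧ I.vars h 3 = v)) → v ∈ varSet I h ∧ u ∈ varSet I h := by
    intro h hh
    rcases hh with ⟨h2, h3⟩ | ⟨h2, h3⟩
    · exact ⟨h2 ▸ vars_mem_varSet I h 2, h3 ▸ vars_mem_varSet I h 3⟩
    · exact ⟨h3 ▸ vars_mem_varSet I h 3, h2 ▸ vars_mem_varSet I h 2⟩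
  have h2 : 1 < (varSet I g ∩ varSet I g').card :=
    Finset.one_lt_card.2 ⟨v, mem_inter.2 ⟨(hv hg).1, (hv hg').1⟩, u, mem_inter.2 ⟨(hv hg).2, (hv hg').2⟩, hvu⟩
  exact absurd (hS g g' hne) (by omega)

/-- **A flip of the partner in a monomial flips `mv v`**: if `g₀ ∈ G` has AND pair `{v, u}`, then
`coef v (x with x_u := b) = coef v (x) + (b + x_u)`. -/
theorem coef_update_of_gate (hI : I.IsPure xorAndPred) (hS : SimpleOverlap I) {g₀ : Fin m} (hg₀ : g₀ ∈ G) {v u : Fin n}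
    (hpair : (I.vars g₀ 2 = v ∧ I.vars g₀ 3 = u) ∨ (I.vars g₀ 2 = u ∧ I.vars g₀ 3 = v)) (x : Fin n → Bool) (b : Bool) :
    coef I C G v (fun w => bit (Function.update x u b w)) = coef I C G v (fun w => bit (x w)) + (bit b + bit (x u)) := by
  classical
  have hvu : v ≠ u := by
    rcases hpair with ⟨h2, h3⟩ | ⟨h2, h3⟩
    · exact fun e => absurd (hI.2 g₀ (h2.trans (e.trans h3.symm))) (by decide)
    · exact fun e => absurd (hI.2 g₀ (h2.trans (e.symm.trans h3.symm))) (by decide)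
  unfold coef
  rw [add_assoc]
  congr 1
  rw [← add_sum_erase G _ hg₀, ← add_sum_erase G _ hg₀, add_comm _ (∑ g ∈ G.erase g₀, _), add_comm _ (∑ g ∈ G.erase g₀, _), add_assoc]
  congr 1
  · refine sum_congr rfl fun g hg => ?_
    have hne : g ≠ g₀ := ne_of_mem_erase hg
    have hno : ¬ ((I.vars g 2 = v ∧ I.vars g 3 = u) ∨ (I.vars g 2 = u ∧ I.vars g 3 = v)) :=
      fun h => hne (eq_of_pair I hS hvu h hpair)
    congr 1
    · by_cases e : I.vars g 2 = v
      · have h3 : I.vars g 3 ≠ u := fun e' => hno (Or.inl ⟨e, e'⟩)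
        rw [if_pos e, if_pos e]
        simp only [Function.update_of_ne h3]
      · rw [if_neg e, if_neg e]
    · by_cases e : I.vars g 3 = v
      · have h2 : I.vars g 2 ≠ u := fun e' => hno (Or.inr ⟨e', e⟩)
        rw [if_pos e, if_pos e]
        simp only [Function.update_of_ne h2]
      · rw [if_neg e, if_neg e]
  · rcases hpair with ⟨h2, h3⟩ | ⟨h2, h3⟩
    · rw [h2, h3, if_pos rfl, if_neg hvu.symm, if_pos rfl, if_neg hvu.symm]
      simp only [Function.update_self, add_zero]
      generalize x u = c; revert b c; decide
    · rw [h2, h3, if_neg hvu.symm, if_pos rfl, if_neg hvu.symm, if_pos rfl]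
      simp only [Function.update_self, zero_add]
      generalize x u = c; revert b c; decide

/-- Boolean form: flipping the partner `u` of `v` in a monomial of `G` flips `mv v`. -/
theorem mv_update_of_gate (hI : I.IsPure xorAndPred) (hS : SimpleOverlap I) {g₀ : Fin m} (hg₀ : g₀ ∈ G) {v u : Fin n}
    (hpair : (I.vars g₀ 2 = v ∧ I.vars g₀ 3 = u) ∨ (I.vars g₀ 2 = u ∧ I.vars g₀ 3 = v)) (x : Fin n → Bool) :
    mv I C G v (Function.update x u (!x u)) = !mv I C G v x := by
  unfold mv
  rw [coef_update_of_gate I C G hI hS hg₀ hpair x (!x u)]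
  have hb : bit (!x u) + bit (x u) = 1 := by cases x u <;> decide
  rw [hb]
  generalize coef I C G v (fun w => bit (x w)) = t
  revert t; decide

/-- **Two flips sharing no monomial act additively.** -/
theorem gval_flip₂ (hI : I.IsPure xorAndPred) (x : Fin n → Bool) {u v : Fin n} (huv : u ≠ v)
    (hno : ∀ g ∈ G, ¬ ((I.vars g 2 = v ∧ I.vars g 3 = u) ∨ (I.vars g 2 = u ∧ I.vars g 3 = v))) :
    gval I C G (Function.update (Function.update x u (!x u)) v (!x v)) = xor (xor (gval I C G x) (mv I C G u x)) (mv I C G v x) := by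
  have e : (!x v) = !(Function.update x u (!x u) v) := by rw [Function.update_of_ne huv.symm]
  rw [e, gval_flip I C G hI, gval_flip I C G hI, mv_update_of_ne I C G hno]

end Move

/-! ## Rank one for arbitrary commuting flips -/
section RankOne

variable {I : LocalMap 4 n m} {r : ℕ} {y : Fin m → Bool} {J₀ : Finset (Fin m)} {w₁ w₂ : Finset (Fin n) × Finset (Fin m) × Bool}

/-- The affine `2 × 2` fact: an affine map `𝔽₂² → 𝔽₂²` with invertible linear part is onto. -/
private theorem affine_hits (g₁ g₂ d₁ d₂ d₁' d₂' b₁ b₂ : Bool) (hdet : (d₁ && d₂') ≠ (d₁' && d₂)) :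
    (g₁ = b₁ ∧ g₂ = b₂) ∨ (xor g₁ d₁ = b₁ ∧ xor g₂ d₂ = b₂) ∨ (xor g₁ d₁' = b₁ ∧ xor g₂ d₂' = b₂) ∨
      (xor (xor g₁ d₁) d₁' = b₁ ∧ xor (xor g₂ d₂) d₂' = b₂) := by
  revert g₁ g₂ d₁ d₂ d₁' d₂' b₁ b₂ hdet; decide

/-- **RANK ONE for two commuting flips.**  Two variables `u ≠ v` sharing no monomial of either reader, such that `x`, `x ⊕ e_u`, `x ⊕ e_v`,
`x ⊕ e_u ⊕ e_v` all solve the core, cannot have INDEPENDENT move vectors `(mv₁ u, mv₂ u)`, `(mv₁ v, mv₂ v)` at `x` — one of the four points would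
satisfy both readers, against (T3). -/
theorem false_of_independent_flips (hI : I.IsPure xorAndPred) (ht : Terminal I r y J₀ w₁ w₂) {x : Fin n → Bool} {u v : Fin n} (huv : u ≠ v)
    (hno : ∀ g ∈ w₁.2.1 ∪ w₂.2.1, ¬ ((I.vars g 2 = v ∧ I.vars g 3 = u) ∨ (I.vars g 2 = u ∧ I.vars g 3 = v)))
    (hx : ∀ j ∈ J₀, I.eval x j = y j) (hxu : ∀ j ∈ J₀, I.eval (Function.update x u (!x u)) j = y j)
    (hxv : ∀ j ∈ J₀, I.eval (Function.update x v (!x v)) j = y j)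
    (hxuv : ∀ j ∈ J₀, I.eval (Function.update (Function.update x u (!x u)) v (!x v)) j = y j)
    (hdet : (mv I w₁.1 w₁.2.1 u x && mv I w₂.1 w₂.2.1 v x) ≠ (mv I w₁.1 w₁.2.1 v x && mv I w₂.1 w₂.2.1 u x)) : False := by
  have hno₁ : ∀ g ∈ w₁.2.1, ¬ ((I.vars g 2 = v ∧ I.vars g 3 = u) ∨ (I.vars g 2 = u ∧ I.vars g 3 = v)) :=
    fun g hg => hno g (mem_union_left _ hg)
  have hno₂ : ∀ g ∈ w₂.2.1, ¬ ((I.vars g 2 = v ∧ I.vars g 3 = u) ∨ (I.vars g 2 = u ∧ I.vars g 3 = v)) :=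
    fun g hg => hno g (mem_union_right _ hg)
  have T := fun (z : Fin n → Bool) (hz : ∀ j ∈ J₀, I.eval z j = y j) (a : gval I w₁.1 w₁.2.1 z = w₁.2.2)
    (b : gval I w₂.1 w₂.2.1 z = w₂.2.2) => ht.2.2.2.2.2.2.1 ⟨z, hz, a, b⟩
  rcases affine_hits (gval I w₁.1 w₁.2.1 x) (gval I w₂.1 w₂.2.1 x) (mv I w₁.1 w₁.2.1 u x) (mv I w₂.1 w₂.2.1 u x)
      (mv I w₁.1 w₁.2.1 v x) (mv I w₂.1 w₂.2.1 v x) w₁.2.2 w₂.2.2 hdet with ⟨h₁, h₂⟩ | ⟨h₁, h₂⟩ | ⟨h₁, h₂⟩ | ⟨h₁, h₂⟩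
  · exact T x hx h₁ h₂
  · exact T _ hxu ((gval_flip I _ _ hI x u).trans h₁) ((gval_flip I _ _ hI x u).trans h₂)
  · exact T _ hxv ((gval_flip I _ _ hI x v).trans h₁) ((gval_flip I _ _ hI x v).trans h₂)
  · exact T _ hxuv ((gval_flip₂ I _ _ hI x huv hno₁).trans h₁) ((gval_flip₂ I _ _ hI x huv hno₂).trans h₂)

/-- **RANK ONE** (contrapositive form): the `2 × 2` determinant of the two move vectors vanishes. -/
theorem rank_one (hI : I.IsPure xorAndPred) (ht : Terminal I r y J₀ w₁ w₂) {x : Fin n → Bool} {u v : Fin n} (huv : u ≠ v)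
    (hno : ∀ g ∈ w₁.2.1 ∪ w₂.2.1, ¬ ((I.vars g 2 = v ∧ I.vars g 3 = u) ∨ (I.vars g 2 = u ∧ I.vars g 3 = v)))
    (hx : ∀ j ∈ J₀, I.eval x j = y j) (hxu : ∀ j ∈ J₀, I.eval (Function.update x u (!x u)) j = y j)
    (hxv : ∀ j ∈ J₀, I.eval (Function.update x v (!x v)) j = y j)
    (hxuv : ∀ j ∈ J₀, I.eval (Function.update (Function.update x u (!x u)) v (!x v)) j = y j) :
    (mv I w₁.1 w₁.2.1 u x && mv I w₂.1 w₂.2.1 v x) = (mv I w₁.1 w₁.2.1 v x && mv I w₂.1 w₂.2.1 u x) := by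
  by_contra hdet
  exact false_of_independent_flips hI ht huv hno hx hxu hxv hxuv hdet

end RankOne

/-! ## Flipping a private of a chord -/
section Priv

variable {I : LocalMap 4 n m} {y : Fin m → Bool} {J₀ : Finset (Fin m)} {c : Fin m}

/-- **Flipping one private of a chord while the other is `0` keeps the core solved** (both slots; `PstarChordReads.solves_update_of_chord` and its
mirror). -/
theorem solves_update_priv (hI : I.IsPure xorAndPred) (hc : c ∈ J₀) (hch : IsChord I J₀ c) {v v' : Fin n}
    (hvv : (I.vars c 2 = v ∧ I.vars c 3 = v') ∨ (I.vars c 2 = v' ∧ I.vars c 3 = v)) {x : Fin n → Bool}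
    (hx : ∀ j ∈ J₀, I.eval x j = y j) (h0 : x v' = false) (b : Bool) : ∀ j ∈ J₀, I.eval (Function.update x v b) j = y j := by
  rcases hvv with ⟨h2, h3⟩ | ⟨h2, h3⟩
  · subst h2; subst h3; exact solves_update_of_chord hI hc hch hx h0 b
  · subst h2; subst h3; exact solves_update_of_chord₃ hI hc hch hx h0 b

/-- The slice `x_v = π, x_{v'} = κ` of `c` in the `(vars c 2, vars c 3)` coordinates. -/
theorem exists_slice_priv {v v' : Fin n} (hvv : (I.vars c 2 = v ∧ I.vars c 3 = v') ∨ (I.vars c 2 = v' ∧ I.vars c 3 = v)) (π κ : Bool) :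
    ∃ π' κ' : Bool, ∀ x : Fin n → Bool, x (I.vars c 2) = π' → x (I.vars c 3) = κ' → x v = π ∧ x v' = κ := by
  rcases hvv with ⟨h2, h3⟩ | ⟨h2, h3⟩
  · exact ⟨π, κ, fun x hp hq => ⟨h2 ▸ hp, h3 ▸ hq⟩⟩
  · exact ⟨κ, π, fun x hp hq => ⟨h3 ▸ hq, h2 ▸ hp⟩⟩

end Priv

/-! ## The finite lemmas -/
section Finite

/-- **TWO-POINT LEMMA.**  If the move vector `a` is parallel to both `aᵢ` and `aᵢ ⊕ λ` (`λ ≠ 0` the type of a gate whose private is flipped), then `a`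
lies on the line of `λ`: `det(λ, a) = 0`. -/
theorem parallel_of_two_point (a₁ a₂ i₁ i₂ l₁ l₂ : Bool)
    (h0 : (i₁ && a₂) = (a₁ && i₂)) (h1 : (xor i₁ l₁ && a₂) = (a₁ && xor i₂ l₂)) : (l₁ && a₂) = (a₁ && l₂) := by
  revert a₁ a₂ i₁ i₂ l₁ l₂ h0 h1; decide

/-- **FOUR-POINT LEMMA.**  If `aᵢ ⊕ εᵢλᵢ` and `aⱼ ⊕ εⱼλⱼ` are parallel for all four `(εᵢ, εⱼ)` and the types `λᵢ, λⱼ` are non-zero, then the types are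
EQUAL (and, by the two-point lemma, both vectors lie on their common line). -/
theorem types_of_four_point (i₁ i₂ j₁ j₂ l₁ l₂ m₁ m₂ : Bool) (hl : (l₁ || l₂) = true) (hm : (m₁ || m₂) = true)
    (h00 : (i₁ && j₂) = (j₁ && i₂)) (h10 : (xor i₁ l₁ && j₂) = (j₁ && xor i₂ l₂))
    (h01 : (i₁ && xor j₂ m₂) = (xor j₁ m₁ && i₂)) (h11 : (xor i₁ l₁ && xor j₂ m₂) = (xor j₁ m₁ && xor i₂ l₂)) :
    l₁ = m₁ ∧ l₂ = m₂ := by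
  revert i₁ i₂ j₁ j₂ l₁ l₂ m₁ m₂ hl hm h00 h10 h01 h11; decide

end Finite

end Summit.PneNP.PneNP.Theorems.PstarChordReadFlip
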